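import Summits.ValiantsHypothesis.ValiantsHypothesis.Theorems.DefinabilityGapPeelingBridge
import HarnessLib

/-!
# DefinabilityGap — isolated independent parts: `P(z_T) + Σ_{c ∈ l} z_c · E_c` is hit

Route `route-ValiantsHypothesis-DefinabilityGap` (decomp-valiant cycle 1, lens 5). Census cells W5 / W19 (size and
independence roads of `KIPlantedHitting`, stmt-ValiantsHypothesis-23547) and F4 / W10 (`KIPlantedHittingRO`,
stmt-ValiantsHypothesis-23704).

The user-facing instances of the peeling bridge `DefinabilityGapPeelingBridge.kiPer_hits_of_peel_to_independent`
(`m ≥ 3`, `G_m = kiPer m`):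

* `kiPerZ_eq_kiPer_of_disjoint` — zeroing cells off a block does not degrade it.
* `kiPer_hits_of_isolated_part` — if the monomials of `D` avoiding every `z_c` (`c ∈ l`) read only blocks in `T`, one of
  them is present, `l` has kill budget and the `cells(l)`-degraded blocks over `T` are algebraically independent, then
  `D(G_m) ≠ 0` — every other monomial of `D` is ARBITRARY.
* `kiPer_hits_add_sum_X_mul` — geometric form: `l` pairwise cell-disjoint, the blocks of `T` cell-disjoint from those of
  `l`, `(P_c)_{c ∈ T}` algebraically independent, `P ≠ 0` reading only `T` ⟹ `P + Σ_{c ∈ l} z_c·E_c` is hit for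
  ARBITRARY `E_c`.
* `kiPer_hits_smallSupport_add_sum_X_mul` — with the tree's transcendence-degree rung
  `DefinabilityGapSupportRung.kiPer_algebraicIndependent` (`2(|T| − 1) < m²`): **every `P ≠ 0` on `≤ m²/2` blocks far
  from `l`, plus `Σ_{c ∈ l} z_c·E_c` with `E_c` arbitrary and any number of pairwise cell-disjoint blocks `c`, is hit** —
  a class covered neither by the support rung (all of `D` on `≤ m²/2 + 1` blocks) nor by the sharp peeling rung (`≤ 2`
  surviving monomials): the two roads composed.

0 sorry.
-/

noncomputable section

open MvPolynomial
open Literature.Computability.AlgebraicComplexity Literature.Computability.MetaComplexity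

namespace Summit.ValiantsHypothesis.ValiantsHypothesis.Theorems.DefinabilityGapIsolatedPart

open Summit.ValiantsHypothesis.ValiantsHypothesis.Theorems.DefinabilityGapAffineRung
open Summit.ValiantsHypothesis.ValiantsHypothesis.Theorems.DefinabilityGapPatternPermanent
open Summit.ValiantsHypothesis.ValiantsHypothesis.Theorems.DefinabilityGapZeroedBlocks
open Summit.ValiantsHypothesis.ValiantsHypothesis.Theorems.DefinabilityGapSparsityRung
open Summit.ValiantsHypothesis.ValiantsHypothesis.Theorems.DefinabilityGapPeelingRung
open Summit.ValiantsHypothesis.ValiantsHypothesis.Theorems.DefinabilityGapPeelingSharp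
open Summit.ValiantsHypothesis.ValiantsHypothesis.Theorems.DefinabilityGapPeelingBridge

variable {m : ℕ}

/-- Zeroing a set of cells disjoint from the block's cells does not degrade the block. [this file] -/
theorem kiPerZ_eq_kiPer_of_disjoint {F : Finset (Fin (qOf m) × Fin (qOf m))} {c : Fin 3 → Fin (qOf m)}
    (h : Disjoint (cells m c) F) : kiPerZ m F c = kiPer m c := by
  rw [← kiPerZ_empty c, kiPerZ_eq_rename, kiPerZ_eq_rename, patOf_eq_empty_of_disjoint h, patOf_empty]

/-- **Isolated independent part.** `m ≥ 3`; `z^{κ₀}` a monomial of `D` avoiding every `z_c`, `c ∈ l`; every monomial of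
`D` avoiding every such `z_c` reads only blocks in `T`; `l` has kill budget; and the `cells(l)`-degraded blocks over `T` are
algebraically independent. Then `D(G_m) ≠ 0` — the monomials of `D` touching some `z_c` are arbitrary. [this file] -/
theorem kiPer_hits_of_isolated_part (hm : 3 ≤ m) {D : MvPolynomial (Fin 3 → Fin (qOf m)) ℂ}
    (l : List (Fin 3 → Fin (qOf m))) (hkill : KillBudget m ∅ l) (T : Finset (Fin 3 → Fin (qOf m)))
    {κ₀ : (Fin 3 → Fin (qOf m)) →₀ ℕ} (hκ₀ : κ₀ ∈ D.support) (h0 : ∀ c ∈ l, κ₀ c = 0)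
    (hT : ∀ κ ∈ D.support, (∀ c ∈ l, κ c = 0) → κ.support ⊆ T)
    (hind : AlgebraicIndependent ℂ (fun c : T => kiPerZ m (cellsOf m l) (c : Fin 3 → Fin (qOf m)))) :
    bind₁ (kiPer m) D ≠ 0 := by
  classical
  have hD : D ≠ 0 := fun h => by
    rw [h, support_zero] at hκ₀
    exact Finset.notMem_empty _ hκ₀
  refine kiPer_hits_of_peel_to_independent hm hD l hkill T (fun κ hκ => ?_) hind
  rw [mem_support_peel_of_avoids l D hκ₀ h0] at hκ
  exact hT κ hκ.1 hκ.2

/-- **`P + Σ_{c ∈ l} z_c·E_c` is hit** (`m ≥ 3`): `l` pairwise cell-disjoint blocks, `T` a family of blocks cell-disjoint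
from those of `l` with `(P_c)_{c ∈ T}` algebraically independent, `P ≠ 0` reading only `T`, `E_c` ARBITRARY. [this file] -/
theorem kiPer_hits_add_sum_X_mul (hm : 3 ≤ m) (l : List (Fin 3 → Fin (qOf m)))
    (hpw : l.Pairwise (fun c c' => Disjoint (cells m c) (cells m c'))) (T : Finset (Fin 3 → Fin (qOf m)))
    (hfar : ∀ c' ∈ T, ∀ c ∈ l, Disjoint (cells m c') (cells m c))
    (hind : AlgebraicIndependent ℂ (fun c : T => kiPer m (c : Fin 3 → Fin (qOf m))))
    {P : MvPolynomial (Fin 3 → Fin (qOf m)) ℂ} (hP : P ≠ 0) (hPT : ∀ κ ∈ P.support, κ.support ⊆ T)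
    (E : (Fin 3 → Fin (qOf m)) → MvPolynomial (Fin 3 → Fin (qOf m)) ℂ) :
    bind₁ (kiPer m) (P + ∑ c ∈ l.toFinset, X c * E c) ≠ 0 := by
  classical
  -- no block of `l` lies in `T`: a block is not cell-disjoint from itself
  have hlT : ∀ c ∈ l, c ∉ T := by
    intro c hc hcT
    have hne : (cells m c).Nonempty := by
      have : Nonempty (Fin m × Fin m) := ⟨(⟨0, by omega⟩, ⟨0, by omega⟩)⟩
      unfold cells
      exact Finset.map_nonempty.2 Finset.univ_nonempty
    exact hne.ne_empty ((Finset.disjoint_self_iff_empty _).1 (hfar c hcT c hc))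
  -- the monomials avoiding every `z_c`, `c ∈ l`, are those of `P`
  have hcoeff : ∀ κ : (Fin 3 → Fin (qOf m)) →₀ ℕ, (∀ c ∈ l, κ c = 0) →
      coeff κ (P + ∑ c ∈ l.toFinset, X c * E c) = coeff κ P := by
    intro κ hκ
    rw [coeff_add, coeff_sum, Finset.sum_eq_zero fun c hc => ?_, add_zero]
    have hc' : c ∉ κ.support := by
      rw [Finsupp.mem_support_iff, not_not]
      exact hκ c (List.mem_toFinset.1 hc)
    rw [coeff_X_mul', if_neg hc']
  have hPl : ∀ κ ∈ P.support, ∀ c ∈ l, κ c = 0 := by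
    intro κ hκ c hc
    by_contra h
    exact hlT c hc (hPT κ hκ (Finsupp.mem_support_iff.2 h))
  obtain ⟨κ₀, hκ₀P⟩ := ne_zero_iff.1 hP
  have hκ₀s : κ₀ ∈ P.support := mem_support_iff.2 hκ₀P
  have hκ₀ : κ₀ ∈ (P + ∑ c ∈ l.toFinset, X c * E c).support := by
    rw [mem_support_iff, hcoeff κ₀ (hPl κ₀ hκ₀s)]
    exact hκ₀P
  refine kiPer_hits_of_isolated_part hm l
    (killBudget_of_pairwise_disjoint (by omega) l ∅ (fun c _ => Finset.disjoint_empty_right _) hpw) T hκ₀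
    (hPl κ₀ hκ₀s) (fun κ hκ hκl => ?_) ?_
  · rw [mem_support_iff, hcoeff κ hκl] at hκ
    exact hPT κ (mem_support_iff.2 hκ)
  · have h : (fun c : T => kiPerZ m (cellsOf m l) (c : Fin 3 → Fin (qOf m))) =
        fun c : T => kiPer m (c : Fin 3 → Fin (qOf m)) := by
      funext c
      exact kiPerZ_eq_kiPer_of_disjoint (disjoint_cellsOf (hfar c c.2))
    rw [h]
    exact hind

/-- **Small independent part + arbitrary multiples of far cell-disjoint blocks** (`m ≥ 3`): every `P ≠ 0` reading a family
`T` of `≤ m²/2` blocks (`2(|T| − 1) < m²`, the tree's transcendence-degree rung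
`DefinabilityGapSupportRung.kiPer_algebraicIndependent`) all cell-disjoint from the pairwise cell-disjoint blocks of `l`,
plus `Σ_{c ∈ l} z_c·E_c` with ARBITRARY `E_c`, is hit by `G_m`. [this file] -/
theorem kiPer_hits_smallSupport_add_sum_X_mul (hm : 3 ≤ m) (l : List (Fin 3 → Fin (qOf m)))
    (hpw : l.Pairwise (fun c c' => Disjoint (cells m c) (cells m c'))) (T : Finset (Fin 3 → Fin (qOf m)))
    (hT : 2 * (T.card - 1) < m * m) (hfar : ∀ c' ∈ T, ∀ c ∈ l, Disjoint (cells m c') (cells m c))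
    {P : MvPolynomial (Fin 3 → Fin (qOf m)) ℂ} (hP : P ≠ 0) (hPT : ∀ κ ∈ P.support, κ.support ⊆ T)
    (E : (Fin 3 → Fin (qOf m)) → MvPolynomial (Fin 3 → Fin (qOf m)) ℂ) :
    bind₁ (kiPer m) (P + ∑ c ∈ l.toFinset, X c * E c) ≠ 0 :=
  kiPer_hits_add_sum_X_mul hm l hpw T hfar (DefinabilityGapSupportRung.kiPer_algebraicIndependent m T hT) hP hPT E

end Summit.ValiantsHypothesis.ValiantsHypothesis.Theorems.DefinabilityGapIsolatedPart

end
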